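import Literature.NumberTheory.Automorphic.HidaIndependenceOfWeightTower
import Literature.NumberTheory.Automorphic.IwahoriUpMultiplicative
import HarnessLib

/-!
# Independence of weight onto the `U_{v,1}`-ordinary part of the Hida tower

Topic `NumberTheory/Automorphic`; namespace `Literature.NumberTheory.Automorphic.BigHeckeGLn.TameLevel`;
theorems only.  The final form of **independence of weight** ([KhareThorne2017, §6.4, Prop. 6.13];
[Hida1994AIF, §2, Prop. 2.1]) for the proof of Hida's control theorem
(`hidaControl_dominantOrdinaryPoint`): `HidaIndependenceOfWeightTower.independenceOfWeight_bijOn_level`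
gives the bijection onto the `[U t_{v,1}^r U]`-ordinary part of `H^i(X_{U(b,c)}, S)`, and
`IwahoriUpMultiplicative.iInf_range_heckeEnd_level_heckeElement_pow` identifies that part with the
`U_{v,1}`-ordinary part `⋂ₙ range U_{v,1}ⁿ` (`U_{v,1} = heckeEnd t_{v,1}`, the operator of the tree's
`ordinaryPart`), for `1 ≤ r ≤ c` and `U` maximal above `p`.

* `TameLevel.independenceOfWeight_bijOn_level_ordinaryPart` — **for finite cohomology groups,
  `Φ_* ∘ (λ₁)_* : H^i(U(b,c), Sym^m(S²))^{ord} → H^i(X_{U(b,c)}, S)^{U_{v,1}-ord}` is a bijection**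
  (`b ≤ c`, `1 ≤ r ≤ c`, `red` killing the closed ball of radius `|ϖ_v|^b`, `red(ϖ_v)^r = 0`).

## References

* C. Khare, J. A. Thorne, *Potential automorphy and the Leopoldt conjecture*, Amer. J. Math. 139
  (2017), §6.4, Prop. 6.13 (arXiv:1409.7007, held). [KhareThorne2017]
* H. Hida, *p-adic ordinary Hecke algebras for GL(2)*, Ann. Inst. Fourier 44 (1994), §2, Prop. 2.1
  (held). [Hida1994AIF]
-/

noncomputable section

open CategoryTheory IsDedekindDomain NumberField

namespace Literature.NumberTheory.Automorphic.BigHeckeGLn.TameLevel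

open LevelAction IntegralWeightGL2

variable {K : Type} [Field K] [NumberField K] {p : ℕ} [Fact p.Prime] (𝒰 : TameLevel 2 K p)
  {v : HeightOneSpectrum (𝓞 K)} (hv : (p : 𝓞 K) ∈ v.asIdeal) {S : Type} [CommRing S]
  (red : v.adicCompletionIntegers K →+* S) {b c : ℕ} (hbc : b ≤ c)
  (hred : ∀ x : v.adicCompletionIntegers K,
    Valued.v (x : v.adicCompletion K) ≤ (WithZero.exp (-(b : ℤ)) : WithZero (Multiplicative ℤ)) →
      red x = 0)
  {Γ : Type} [Group Γ] (ι : Γ →* FiniteAdelicGL 2 K) (m r i : ℕ)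

/-- **Independence of weight onto the `U_{v,1}`-ordinary part of the Hida tower.**  For `U` maximal
above `p`, `b ≤ c`, `1 ≤ r ≤ c`, `red : 𝒪_v → S` killing the closed ball of radius `|ϖ_v|^b` with
`red(ϖ_v)^r = 0`, and finite cohomology groups, the composite
`H^i(U(b,c), Sym^m(S²)) →(λ₁)_*→ H^i(U(b,c), S(χ_m)) ≅ H^i(X_{U(b,c)}, S)` is a bijection from the
`[U t_{v,1}^r U]`-ordinary part onto the `U_{v,1}`-ordinary part `⋂ₙ range (heckeEnd t_{v,1})ⁿ`.
[cite: KhareThorne2017, §6.4, Prop. 6.13] [cite: Hida1994AIF, §2, Prop. 2.1] -/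
theorem independenceOfWeight_bijOn_level_ordinaryPart (h𝒰 : 𝒰.IsMaximalAbove) (hr1 : 1 ≤ r) (hrc : r ≤ c)
    (hr : red ⟨_, uniformizerAt_mem_adicCompletionIntegers K v⟩ ^ r = 0)
    [Finite (cohomology ι (iwahoriMonoid K v red) (symPowCoeff K v red m) (𝒰.level b c) i)]
    [Finite (ArithmeticQuotient.cohomology S ι (𝒰.level b c) S i)] :
    Set.BijOn
      ((cohomologyIso ι (iwahoriMonoid K v red) (lowChar K v red m) (𝒰.level b c)
          (𝒰.level_le_iwahoriMonoid' hv red hbc hred) (𝒰.lowChar_eq_one_of_mem_level hv red hbc hred m) i).hom.hom ∘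
        (pushforwardCohomology ι (iwahoriMonoid K v red) (symPowCoeff K v red m) (lowChar K v red m)
          (𝒰.level b c) (coeffX₁ S m) (coeffX₁_comp_symPowCoeff m) i).hom)
      (⨅ n : ℕ, LinearMap.range (heckeCohomology ι (iwahoriMonoid K v red) (symPowCoeff K v red m)
        (𝒰.level b c) (𝒰.level_le_iwahoriMonoid' hv red hbc hred)
        (heckeElement_pow_mem_iwahoriMonoid K v red r) i ^ n) : Submodule S _)
      (⨅ n : ℕ, LinearMap.range
        (ArithmeticQuotient.heckeEnd S (𝒰.level b c) (heckeElement 2 K v 1) S ι i ^ n) : Submodule S _) := by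
  have h := 𝒰.independenceOfWeight_bijOn_level hv red hbc hred ι m r i hr
  rwa [𝒰.iInf_range_heckeEnd_level_heckeElement_pow S S ι h𝒰 hv hr1 hrc i] at h

end Literature.NumberTheory.Automorphic.BigHeckeGLn.TameLevel
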